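import Literature.MathematicalPhysics.QuantumFieldTheory.Balaban1983to89.B9Eq383QSemiLocal
import Literature.MathematicalPhysics.QuantumFieldTheory.Balaban1983to89.B9Eq315QFlatNorm
import Literature.MathematicalPhysics.QuantumFieldTheory.Balaban1983to89.B9Eq311PointwiseMultipliers

/-!
# `Balaban1983to89.B9Eq349ConjugatedQLetters` — T. Bałaban, *Propagators for lattice gauge theories in a background field*, Commun. Math. Phys. **99**
# (1985) 389–434 [Balaban1985BackgroundPropagators] (3.15)–(3.16) p. 393, (3.26) p. 395, (3.49) p. 399, (3.83) p. 407, (3.101)–(3.103) p. 414: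
# **THE COMBES–THOMAS CONJUGATION LETTERS OF THE VECTOR AVERAGING `Q(U)`** ([B7] (122), one step, on the chain's weighted `L²` bond spaces):
# `‖S_F Q(U) S⁻¹ − Q(U)‖ ≤ 2‖κ‖ℓ′·M_φ′M_φ·√(2(c₁∕c₀)(2d·(102(d+1)²Lε_U)² + L^{−d}))`, its adjoint reading, and the factorisation
# `S Q†(a•Q(S⁻¹f)) = a•(SQ†S_F⁻¹)((S_FQS⁻¹)f)` — the `hQfac`∕`dQ`∕`dQ′` letters of the route's perturbed-coercivity files

statement-level skeleton of published theorems with citation tags; proofs where landed; nothing here is a claim about the Yang–Mills mass gap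

CITATION HEADER (lean-in-tree rule).  Audit cell `pub-balaban`, sub-cell `t4`, BINDER row NE9; filed by the NE9 BINDER-row OWNER lineage
`b2b-balaban-t4-ne9-p1` (gen 93).  Imports ne9-leaf-03's `B9Eq383QSemiLocal` (`QtorusLin_congr_local` — SEMI-LOCALITY of `Q(U)`: `(Q(U)A)(c)` reads `A`
on the fine bonds based in `B(c₋) ∪ B(c₊)` only; `norm_QtorusLin_sub_flat_le_local`; `sum_sum_near_le`; `norm_le_sqrt_sum_near`) and `B9Eq315QFlatNorm`
(`norm_sq_QtorusLin_one_apply_le`, `sum_chart_le` — the flat count) and ne9-leaf-06's `B9Eq311PointwiseMultipliers` (`equiv_adjoint_of_pointwise`,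
`norm_conj_adjoint_sub_le`); through them this lineage's `B9Eq315QTorus` (`QtorusLin`, `QtorusW` = print's one-step `Q(U)` of (3.15) on the chain's
carriers).  Sources READ first-hand (`paper:balaban1985-cmp99-background-propagators`, journal page = PDF page + 388): p. 393 (3.15)–(3.16); p. 399 (3.49);
p. 407 (3.83) («with the norm |A′| restricted to the blocks»); p. 414 (3.101)–(3.103) (print's own exponential-weight conjugation inside the random walk).
Print never conjugates `Q(U)`; the cell's Combes–Thomas route DISPLAYS `∃ Q_κ, Q′_κ` with `S Q†(a•Q(S⁻¹f)) = a•Q′_κ(Q_κ f)`, `‖Q_κ − Q‖ ≤ β`, `‖Q′_κ − Q†‖ ≤ β`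
(`B9Eq326ConjugatedLocalLetters.norm_Gk_le` ∕ `B9Eq326ConjugatedLocalPart.norm_conjLocalInv_le` for `A₀`; ne9-leaf-03's `B9Eq326ConjugatedDeltaA.
norm_conjG1ofU_le` for `Δ_a`); this file DISCHARGES them at `Q := QtorusW` (one step) with `Q_κ := S_F∘Q∘S⁻¹`, `Q′_κ := S∘Q†∘S_F⁻¹`.  The SITE-averaging
twin (`Q̃′_k`, exact big-block locality) is ne9-leaf-03's `B9Eq349ConjugatedDPChainLettersTower`; the vector averaging is only SEMI-local (the straight
contours of (122) leave the block), whence the two-block cut-off datum `ℓ′` below and the route through the flat count + the local Lipschitz letter.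

WHAT IS PROVED (sorry-free; proof lane — no `def`; [folklore] finite sums + Hilbert-space plumbing; nothing of [B9] asserted).  Data: the one-step torus
`T_{Lm} → T_m`, `U` with the (3.35)-type letters of `B9Eq315QTorus` (`hα1 hU1 hreg`) and `‖U(b) − 1‖ ≤ ε_U`, flat data `hα1′ hU1′ hreg′`, fibre `φ` with
`M_φ, M_φ′`, weights `c₀, c₁`; cut-offs `χ` (fine sites), `χ′` (unit-lattice sites) with the TWO-BLOCK reading `|χ′(c₋) − χ(b₋)| ≤ ℓ′` whenever `b₋ ∈ B(c₋) ∪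
B(c₊)`, window `‖κ‖ℓ′ ≤ 1`; multipliers `S, S⁻¹` (fine bonds, `e^{±κχ(b₋)}`), `S_F, S_F⁻¹` (coarse bonds, `e^{±κχ′(c₋)}`) given by their pointwise action.
* §1 `norm_ratio_sub_one_le` (`‖e^{κχ′(c₋)}e^{−κχ(b₋)} − 1‖ ≤ 2‖κ‖ℓ′` near `c`); **`equiv_conj_QtorusW_sub`** — THE IDENTITY
  `(S_FQS⁻¹f − Qf)(c) = φ⁻¹(Q(U)(r_c•Φf))(c)`, `r_c(b) = e^{κχ′(c₋)}e^{−κχ(b₋)} − 1` (linearity only);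
  `sum_flat_count_le` (the flat count of `B9Eq315QFlatNorm` for a raw double sum).
* §2 `sum_norm_sq_QtorusLin_conj_le` (the RAW `ℓ²` form for `𝔸`-valued `A`: `Σ_c‖Q(U)(r_c•A)(c)‖² ≤ (2‖κ‖ℓ′)²·2(2d(102(d+1)²Lε_U)² + L^{−d})·Σ‖A‖²` —
  the brick a TOWER port telescopes over), **`norm_conj_QtorusW_sub_le`**: `‖S_F(Q(S⁻¹f)) − Qf‖ ≤ 2‖κ‖ℓ′·M_φ′M_φ·√(2(c₁∕c₀)·(2d·(102(d+1)²Lε_U)² + (L^d)⁻¹))·‖f‖` — per coarse bond the flat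
  mean of the TRUNCATED `r_c•Φf` (`≤ 2‖κ‖ℓ′ ×` the flat mean of `‖Φf‖`, Cauchy–Schwarz, the flat count) plus the LOCAL Lipschitz letter at `a_c = 2‖κ‖ℓ′·M_φ·
  √(Σ_{b near c}‖f b‖²)` (`sum_sum_near_le`); on print's diagonal `c₁ = c₀L^d` the constant is `2‖κ‖ℓ′·M_φ′M_φ·√(2 + 4dL^d(102(d+1)²Lε_U)²)`.
* §3 `norm_conj_QtorusW_sub_le_negConj` (the same at `−κ̄`, through the adjoints' pointwise action), **`norm_conj_adjoint_QtorusW_sub_le`**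
  (`‖S(Q†(S_F⁻¹g)) − Q†g‖ ≤` the same `× ‖g‖`), **`conj_QadjQ_factor`** (`S(Q†(a•Q(S⁻¹f))) = a•(S∘Q†∘S_F⁻¹)((S_F∘Q∘S⁻¹)f)` given `S_F⁻¹S_F = 1`) — the
  `hQfac`∕`dQ`∕`dQ′` hypotheses of `B9Eq326ConjugatedLocalPart.norm_conjLocalInv_le` ∕ `B9Eq326ConjugatedDeltaA.norm_conjG1ofU_le` at `Q := QtorusW`,
  `Qk := S_F ∘ₗ Q ∘ₗ Sinv`, `Qk′ := S ∘ₗ Q† ∘ₗ S_Finv`.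
HONEST SCOPE.  One step only (the tower `Q_k(U)` needs the same two ingredients at `k` levels); crude constants; every letter DISPLAYED; nothing of [B9]
Thm 3.1∕3.3∕3.11 asserted; «NE9 ⇐ the named binders»; NE9 NOT PRINTED ∕ NOT PROVED; row WALLED ON A MODEL (O-NE9-1; #5 UNRULED); spine PROVED 0∕9; rung
(B)+1 on a finite T⁴ — NOT infinite volume, NOT mass gap, NOT BetaPertH, NOT Clay.  HONEST DEPENDENCY: continuum YM on T⁴ ⇐ BetaPertH ∧ nine spine estimates
(0/9 proved); BetaPertH ⇐ (D1) ∧ (D4) ∧ CAP+tail.  NEW file; nothing modified.  Net new unproved facts: 0.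
-/

noncomputable section

open scoped InnerProductSpace ComplexConjugate BigOperators

namespace Literature.MathematicalPhysics.QuantumFieldTheory.Balaban1983to89.B9Eq349ConjugatedQLetters

open B4Sect5Torus (TSite)
open B9SectCLatticeCarrier (Bond shift)
open B7Prop1Explicit (U1 Wcx boxVec e)
open B9Eq319QprimeTorus (fineP blockCoord)
open B9Eq311L2Pairing (WL2)
open B11Eq103H1Complex (BondL2K)
open B9Eq315QTorus (perCfg perSite cornerSite QtorusLin QtorusLin_apply QtorusW QtorusW_apply)
open B9Eq383QSemiLocal (QtorusLin_congr_local norm_QtorusLin_sub_flat_le_local sum_sum_near_le norm_le_sqrt_sum_near)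
open B9Eq315QFlatNorm (norm_sq_QtorusLin_one_apply_le sum_chart_le)

variable {d : ℕ} (L : ℕ) (m : Fin d → ℕ) [∀ i, NeZero (fineP L m i)]

/-! ## §1 The ratio weights, the pointwise identity, the flat count -/

section Pointwise

/-- **`‖e^{κa}·e^{−κb} − 1‖ ≤ 2‖κ‖ℓ′`** for `|a − b| ≤ ℓ′` in the window `‖κ‖ℓ′ ≤ 1`. [folklore] [cite: Balaban1985BackgroundPropagators, (3.49) p.399] -/
theorem norm_ratio_sub_one_le {κ : ℂ} {ℓ' a b : ℝ} (hab : |a - b| ≤ ℓ') (hwin : ‖κ‖ * ℓ' ≤ 1) :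
    ‖Complex.exp (κ * (a : ℂ)) * Complex.exp (-(κ * (b : ℂ))) - 1‖ ≤ 2 * (‖κ‖ * ℓ') := by
  have hz : ‖κ * (a : ℂ) + -(κ * (b : ℂ))‖ ≤ ‖κ‖ * ℓ' := by
    rw [← sub_eq_add_neg, ← mul_sub, norm_mul, ← Complex.ofReal_sub, Complex.norm_real, Real.norm_eq_abs]
    exact mul_le_mul_of_nonneg_left hab (norm_nonneg κ)
  rw [← Complex.exp_add]
  calc ‖Complex.exp (κ * (a : ℂ) + -(κ * (b : ℂ))) - 1‖ ≤ 2 * ‖κ * (a : ℂ) + -(κ * (b : ℂ))‖ := Complex.norm_exp_sub_one_le (hz.trans hwin)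
    _ ≤ 2 * (‖κ‖ * ℓ') := by linarith

variable {𝔸 : Type*} [NormedRing 𝔸] [NormedAlgebra ℂ 𝔸] [CompleteSpace 𝔸] [NormOneClass 𝔸] (hL : 1 ≤ L)
  {W : Type*} [NormedAddCommGroup W] [InnerProductSpace ℂ W] (φ : W ≃ₗ[ℂ] 𝔸) {c₀ c₁ : ℝ}
  (U : Bond d (fineP L m) → 𝔸ˣ) {α : ℝ} (hα1 : α ≤ 1 / 64)
  (hU1 : ∀ (x : B7Prop1Explicit.Site d) (κ : Fin d), perCfg (fineP L m) U x κ ∈ U1 𝔸)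
  (hreg : ∀ (y : TSite d m) (κ : Fin d) (r : Fin d → Fin L),
    ‖((Wcx L (perCfg (fineP L m) U) (cornerSite L y) κ (boxVec L r) : 𝔸ˣ) : 𝔸) - 1‖ ≤ α)
  {κ : ℂ} {χ : TSite d (fineP L m) → ℝ} {χ' : TSite d m → ℝ}
  {Sinv : BondL2K ℂ d (fineP L m) c₀ W →ₗ[ℂ] BondL2K ℂ d (fineP L m) c₀ W}
  (hSinv : ∀ (f : BondL2K ℂ d (fineP L m) c₀ W) (b : Bond d (fineP L m)),
    WL2.equiv ℂ (fun _ : Bond d (fineP L m) => c₀) W (Sinv f) b =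
      Complex.exp (-(κ * (χ b.1 : ℂ))) • WL2.equiv ℂ (fun _ : Bond d (fineP L m) => c₀) W f b)
  {SF : BondL2K ℂ d m c₁ W →ₗ[ℂ] BondL2K ℂ d m c₁ W}
  (hSF : ∀ (g : BondL2K ℂ d m c₁ W) (c : Bond d m),
    WL2.equiv ℂ (fun _ : Bond d m => c₁) W (SF g) c = Complex.exp (κ * (χ' c.1 : ℂ)) • WL2.equiv ℂ (fun _ : Bond d m => c₁) W g c)

include hSinv hSF in
/-- **THE IDENTITY**: `(S_F Q S⁻¹ f − Q f)(c) = φ⁻¹·(Q(U)(r_c•Φf))(c)` with `r_c(b) = e^{κχ′(c₋)}e^{−κχ(b₋)} − 1` and `Φf = φ∘f` — by linearity of `Q(U)`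
alone (`e^{κχ′(c₋)}•Q(e^{−κχ}•g) = Q((1 + r_c)•g)` at the point `c`). [cite: Balaban1985BackgroundPropagators, (3.15) p.393, (3.101) p.414] -/
theorem equiv_conj_QtorusW_sub (f : BondL2K ℂ d (fineP L m) c₀ W) (c : Bond d m) :
    WL2.equiv ℂ (fun _ : Bond d m => c₁) W (SF (QtorusW L m hL φ U hα1 hU1 hreg (c₁ := c₁) (Sinv f))) c -
        WL2.equiv ℂ (fun _ : Bond d m => c₁) W (QtorusW L m hL φ U hα1 hU1 hreg (c₁ := c₁) f) c =
      φ.symm (QtorusLin L m hL U hα1 hU1 hreg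
        (fun b => (Complex.exp (κ * (χ' c.1 : ℂ)) * Complex.exp (-(κ * (χ b.1 : ℂ))) - 1) • φ (WL2.equiv ℂ (fun _ : Bond d (fineP L m) => c₀) W f b)) c) := by
  set g : Bond d (fineP L m) → 𝔸 := fun b => φ (WL2.equiv ℂ (fun _ : Bond d (fineP L m) => c₀) W f b) with hg
  have hS' : (fun b => φ (WL2.equiv ℂ (fun _ : Bond d (fineP L m) => c₀) W (Sinv f) b)) =
      fun b => Complex.exp (-(κ * (χ b.1 : ℂ))) • g b := funext fun b => by rw [hSinv, LinearEquiv.map_smul]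
  have hfun : (Complex.exp (κ * (χ' c.1 : ℂ)) • fun b => Complex.exp (-(κ * (χ b.1 : ℂ))) • g b) - g =
      fun b => (Complex.exp (κ * (χ' c.1 : ℂ)) * Complex.exp (-(κ * (χ b.1 : ℂ))) - 1) • g b := by
    funext b; simp only [Pi.sub_apply, Pi.smul_apply, smul_smul, sub_smul, one_smul]
  rw [hSF, QtorusW_apply, QtorusW_apply, ← LinearEquiv.map_smul, ← map_sub, hS', ← Pi.smul_apply (Complex.exp (κ * (χ' c.1 : ℂ))),
    ← LinearMap.map_smul, ← Pi.sub_apply, ← map_sub, hfun]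

omit [∀ i, NeZero (fineP L m i)] in
include hL in
/-- **THE FLAT COUNT for a raw double sum** (the re-indexing of `B9Eq315QFlatNorm.sum_norm_sq_QtorusLin_one_le`): for `t ≥ 0` on fine bonds,
`Σ_c L^{−(d+1)}·Σ_r Σ_{i<L} t((L·c₋ + r + ie_{c.2}) mod, c.2) ≤ L^{−d}·Σ_b t(b)`. [folklore] [cite: Balaban1985Averaging, (125) p.36] -/
theorem sum_flat_count_le [∀ i, NeZero (fineP L m i)] (t : Bond d (fineP L m) → ℝ) (ht : ∀ b, 0 ≤ t b) :
    ∑ c : Bond d m, ((L : ℝ) ^ (d + 1))⁻¹ * ∑ r : Fin d → Fin L, ∑ i ∈ Finset.range L,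
        t (perSite (fineP L m) (cornerSite L c.1 + boxVec L r + (i : ℤ) • e c.2), c.2) ≤ ((L : ℝ) ^ d)⁻¹ * ∑ b, t b := by
  haveI : NeZero L := ⟨by omega⟩
  have hL0 : (L : ℝ) ≠ 0 := by exact_mod_cast (by omega : L ≠ 0)
  set s : Fin d → ℕ → TSite d m → (Fin d → Fin L) → ℝ :=
    fun k i y r => t (perSite (fineP L m) (cornerSite L y + boxVec L r + (i : ℤ) • e k), k) with hs
  have hshift : ∀ (k : Fin d) (i : ℕ), ∑ p : TSite d m × (Fin d → Fin L), s k i p.1 p.2 ≤ ∑ x : TSite d (fineP L m), t (x, k) :=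
    fun k i => sum_chart_le L m ((i : ℤ) • e k) (g := fun x => t (x, k)) fun x => ht _
  have hre : ∑ c : Bond d m, ∑ r : Fin d → Fin L, ∑ i ∈ Finset.range L, s c.2 i c.1 r =
      ∑ k : Fin d, ∑ i ∈ Finset.range L, ∑ p : TSite d m × (Fin d → Fin L), s k i p.1 p.2 := by
    rw [Fintype.sum_prod_type, Finset.sum_comm]
    refine Finset.sum_congr rfl fun k _ => ?_
    calc ∑ y : TSite d m, ∑ r : Fin d → Fin L, ∑ i ∈ Finset.range L, s k i y r
        = ∑ y : TSite d m, ∑ i ∈ Finset.range L, ∑ r : Fin d → Fin L, s k i y r := Finset.sum_congr rfl fun y _ => Finset.sum_comm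
      _ = ∑ i ∈ Finset.range L, ∑ y : TSite d m, ∑ r : Fin d → Fin L, s k i y r := Finset.sum_comm
      _ = ∑ i ∈ Finset.range L, ∑ p : TSite d m × (Fin d → Fin L), s k i p.1 p.2 :=
          Finset.sum_congr rfl fun i _ => (Fintype.sum_prod_type' _).symm
  have hb : ∑ b : Bond d (fineP L m), t b = ∑ k : Fin d, ∑ x : TSite d (fineP L m), t (x, k) := by
    rw [Fintype.sum_prod_type, Finset.sum_comm]
  calc ∑ c : Bond d m, ((L : ℝ) ^ (d + 1))⁻¹ * ∑ r : Fin d → Fin L, ∑ i ∈ Finset.range L, s c.2 i c.1 r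
      = ((L : ℝ) ^ (d + 1))⁻¹ * ∑ k : Fin d, ∑ i ∈ Finset.range L, ∑ p : TSite d m × (Fin d → Fin L), s k i p.1 p.2 := by
        rw [← Finset.mul_sum, hre]
    _ ≤ ((L : ℝ) ^ (d + 1))⁻¹ * ∑ k : Fin d, ∑ _i ∈ Finset.range L, ∑ x : TSite d (fineP L m), t (x, k) :=
        mul_le_mul_of_nonneg_left (Finset.sum_le_sum fun k _ => Finset.sum_le_sum fun i _ => hshift k i) (by positivity)
    _ = ((L : ℝ) ^ d)⁻¹ * ∑ b, t b := by
        rw [hb]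
        simp only [Finset.sum_const, Finset.card_range, nsmul_eq_mul]
        rw [← Finset.mul_sum, pow_succ]
        field_simp

end Pointwise

/-! ## §2 The `L²` letter `‖S_F Q(U) S⁻¹ − Q(U)‖` -/

section Letter

variable {𝔸 : Type*} [NormedRing 𝔸] [NormedAlgebra ℂ 𝔸] [CompleteSpace 𝔸] [NormOneClass 𝔸] (hL : 1 ≤ L)
  (U : Bond d (fineP L m) → 𝔸ˣ) {α : ℝ} (hα1 : α ≤ 1 / 64)
  (hU1 : ∀ (x : B7Prop1Explicit.Site d) (κ : Fin d), perCfg (fineP L m) U x κ ∈ U1 𝔸)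
  (hreg : ∀ (y : TSite d m) (κ : Fin d) (r : Fin d → Fin L),
    ‖((Wcx L (perCfg (fineP L m) U) (cornerSite L y) κ (boxVec L r) : 𝔸ˣ) : 𝔸) - 1‖ ≤ α)
  {α' : ℝ} (hα1' : α' ≤ 1 / 64)
  (hU1' : ∀ (x : B7Prop1Explicit.Site d) (κ : Fin d), perCfg (fineP L m) (fun _ : Bond d (fineP L m) => (1 : 𝔸ˣ)) x κ ∈ U1 𝔸)
  (hreg' : ∀ (y : TSite d m) (κ : Fin d) (r : Fin d → Fin L),
    ‖((Wcx L (perCfg (fineP L m) (fun _ : Bond d (fineP L m) => (1 : 𝔸ˣ))) (cornerSite L y) κ (boxVec L r) : 𝔸ˣ) : 𝔸) - 1‖ ≤ α')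
  {εU : ℝ} (hεU : 0 ≤ εU) (hUε : ∀ b : Bond d (fineP L m), ‖(U b : 𝔸) - 1‖ ≤ εU)
  {W : Type*} [NormedAddCommGroup W] [InnerProductSpace ℂ W] (φ : W ≃ₗ[ℂ] 𝔸) {c₀ c₁ : ℝ} [Fact (0 < c₀)] [Fact (0 < c₁)]
  {Mφ Mφ' : ℝ} (hMφ : 0 ≤ Mφ) (hφ : ∀ w, ‖φ w‖ ≤ Mφ * ‖w‖) (hMφ' : 0 ≤ Mφ') (hφ' : ∀ X, ‖φ.symm X‖ ≤ Mφ' * ‖X‖)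
  {κ : ℂ} {χ : TSite d (fineP L m) → ℝ} {χ' : TSite d m → ℝ} {ℓ' : ℝ} (hℓ' : 0 ≤ ℓ')
  (hχ' : ∀ (c : Bond d m) (b : Bond d (fineP L m)), (blockCoord L m b.1 = c.1 ∨ blockCoord L m b.1 = shift c.2 c.1) → |χ' c.1 - χ b.1| ≤ ℓ')
  (hwin' : ‖κ‖ * ℓ' ≤ 1)
  {Sinv : BondL2K ℂ d (fineP L m) c₀ W →ₗ[ℂ] BondL2K ℂ d (fineP L m) c₀ W}
  (hSinv : ∀ (f : BondL2K ℂ d (fineP L m) c₀ W) (b : Bond d (fineP L m)),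
    WL2.equiv ℂ (fun _ : Bond d (fineP L m) => c₀) W (Sinv f) b =
      Complex.exp (-(κ * (χ b.1 : ℂ))) • WL2.equiv ℂ (fun _ : Bond d (fineP L m) => c₀) W f b)
  {SF : BondL2K ℂ d m c₁ W →ₗ[ℂ] BondL2K ℂ d m c₁ W}
  (hSF : ∀ (g : BondL2K ℂ d m c₁ W) (c : Bond d m),
    WL2.equiv ℂ (fun _ : Bond d m => c₁) W (SF g) c = Complex.exp (κ * (χ' c.1 : ℂ)) • WL2.equiv ℂ (fun _ : Bond d m => c₁) W g c)

include hα1' hU1' hreg' hεU hUε hℓ' hχ' hwin' in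
/-- **THE RAW `ℓ²` FORM (for `𝔸`-valued bond functions; the tower port telescopes over it): `Σ_c ‖(Q(U)(r_c•A))(c)‖² ≤ (2‖κ‖ℓ′)²·2(2d·(102(d+1)²Lε_U)² +
L^{−d})·Σ_b ‖A b‖²`, `r_c(b) = e^{κχ′(c₋)}e^{−κχ(b₋)} − 1`.**  Per coarse bond: `‖r_c‖ ≤ 2‖κ‖ℓ′` on `B(c₋) ∪ B(c₊)`; `Q(U)(r_c•A)(c) = [Q(U) − Q(1)](r_c•A)(c)
+ Q(1)(r_c•A)(c)`, the first by leaf-03's LOCAL Lipschitz letter at `a_c = 2‖κ‖ℓ′·√(Σ_{b near c}‖A b‖²)`, the second = `Q(1)` of the TRUNCATION of `r_c•A` to the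
two blocks (`QtorusLin_congr_local`), squared by `norm_sq_QtorusLin_one_apply_le`; then `(a+b)² ≤ 2(a²+b²)`, `sum_sum_near_le` (multiplicity `2d`) and
`sum_flat_count_le`. [cite: Balaban1985BackgroundPropagators, (3.15)–(3.16) p.393, (3.49) p.399, (3.83) p.407, (3.101) p.414] -/
theorem sum_norm_sq_QtorusLin_conj_le (A : Bond d (fineP L m) → 𝔸) :
    ∑ c : Bond d m, ‖QtorusLin L m hL U hα1 hU1 hreg
        (fun b => (Complex.exp (κ * (χ' c.1 : ℂ)) * Complex.exp (-(κ * (χ b.1 : ℂ))) - 1) • A b) c‖ ^ 2 ≤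
      (2 * (‖κ‖ * ℓ')) ^ 2 * (2 * (2 * d * (102 * (d + 1) ^ 2 * L * εU) ^ 2 + ((L : ℝ) ^ d)⁻¹)) * ∑ b : Bond d (fineP L m), ‖A b‖ ^ 2 := by
  classical
  haveI : NeZero L := ⟨by omega⟩
  have hLd : (0 : ℝ) < (L : ℝ) ^ d := by positivity
  set ω : ℝ := 2 * (‖κ‖ * ℓ') with hω
  have hω0 : 0 ≤ ω := by positivity
  set K₁ : ℝ := 102 * (d + 1) ^ 2 * L * εU with hK₁
  have hK₁0 : 0 ≤ K₁ := by positivity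
  -- the ratio weights
  set r : Bond d m → Bond d (fineP L m) → ℂ := fun c b => Complex.exp (κ * (χ' c.1 : ℂ)) * Complex.exp (-(κ * (χ b.1 : ℂ))) - 1 with hr
  have hrω : ∀ (c : Bond d m) (b : Bond d (fineP L m)), (blockCoord L m b.1 = c.1 ∨ blockCoord L m b.1 = shift c.2 c.1) → ‖r c b‖ ≤ ω :=
    fun c b hb => norm_ratio_sub_one_le (hχ' c b hb) hwin'
  -- the local sizes of `A`
  set s : Bond d m → ℝ := fun c => Real.sqrt (∑ b ∈ Finset.univ.filter
    (fun b : Bond d (fineP L m) => blockCoord L m b.1 = c.1 ∨ blockCoord L m b.1 = shift c.2 c.1), ‖A b‖ ^ 2) with hs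
  have hs0 : ∀ c, 0 ≤ s c := fun c => Real.sqrt_nonneg _
  have hga : ∀ (c : Bond d m) (b : Bond d (fineP L m)), (blockCoord L m b.1 = c.1 ∨ blockCoord L m b.1 = shift c.2 c.1) → ‖A b‖ ≤ s c :=
    fun c b hb => norm_le_sqrt_sum_near _ A (by simpa using hb)
  -- the flat mean of `‖A‖²` over the contour bonds of `c`
  set q : Bond d m → ℝ := fun c => ((L : ℝ) ^ (d + 1))⁻¹ * ∑ ρ : Fin d → Fin L, ∑ i ∈ Finset.range L,
    ‖A (perSite (fineP L m) (cornerSite L c.1 + boxVec L ρ + (i : ℤ) • e c.2), c.2)‖ ^ 2 with hq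
  have hq0 : ∀ c, 0 ≤ q c := fun c => by simp only [hq]; positivity
  -- (i) the Lipschitz part, pointwise
  have hlip : ∀ c : Bond d m, ‖QtorusLin L m hL U hα1 hU1 hreg (fun b => r c b • A b) c -
      QtorusLin L m hL (fun _ => 1) hα1' hU1' hreg' (fun b => r c b • A b) c‖ ≤ K₁ * (ω * s c) := fun c =>
    norm_QtorusLin_sub_flat_le_local L m hL U hα1 hU1 hreg hα1' hU1' hreg' hεU hUε (fun b => r c b • A b) c
      (mul_nonneg hω0 (hs0 c)) fun b hb => (norm_smul_le _ _).trans (mul_le_mul (hrω c b hb) (hga c b hb) (norm_nonneg _) hω0)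
  -- (ii) the flat part, pointwise in square
  have hflat : ∀ c : Bond d m, ‖QtorusLin L m hL (fun _ => 1) hα1' hU1' hreg' (fun b => r c b • A b) c‖ ^ 2 ≤ ω ^ 2 * q c := by
    intro c
    set A' : Bond d (fineP L m) → 𝔸 := fun b =>
      if blockCoord L m b.1 = c.1 ∨ blockCoord L m b.1 = shift c.2 c.1 then r c b • A b else 0 with hA'
    have hAA' : ∀ b : Bond d (fineP L m), (blockCoord L m b.1 = c.1 ∨ blockCoord L m b.1 = shift c.2 c.1) → r c b • A b = A' b :=
      fun b hb => by rw [hA']; dsimp only; rw [if_pos hb]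
    have hA'g : ∀ b, ‖A' b‖ ^ 2 ≤ ω ^ 2 * ‖A b‖ ^ 2 := fun b => by
      rw [hA']; dsimp only
      split_ifs with hb
      · rw [← mul_pow]
        exact pow_le_pow_left₀ (norm_nonneg _) ((norm_smul_le _ _).trans (mul_le_mul_of_nonneg_right (hrω c b hb) (norm_nonneg _))) 2
      · rw [norm_zero, zero_pow two_ne_zero]; positivity
    rw [QtorusLin_congr_local L m hL (fun _ => 1) hα1' hU1' hreg' c hAA']
    refine (norm_sq_QtorusLin_one_apply_le L m hL hα1' hU1' hreg' A' c).trans ?_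
    have hsum : ∑ ρ : Fin d → Fin L, ∑ i ∈ Finset.range L, ‖A' (perSite (fineP L m) (cornerSite L c.1 + boxVec L ρ + (i : ℤ) • e c.2), c.2)‖ ^ 2 ≤
        ω ^ 2 * ∑ ρ : Fin d → Fin L, ∑ i ∈ Finset.range L, ‖A (perSite (fineP L m) (cornerSite L c.1 + boxVec L ρ + (i : ℤ) • e c.2), c.2)‖ ^ 2 := by
      rw [Finset.mul_sum]
      refine Finset.sum_le_sum fun ρ _ => ?_
      rw [Finset.mul_sum]
      exact Finset.sum_le_sum fun i _ => hA'g _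
    calc _ ≤ ((L : ℝ) ^ (d + 1))⁻¹ * (ω ^ 2 * ∑ ρ : Fin d → Fin L, ∑ i ∈ Finset.range L,
          ‖A (perSite (fineP L m) (cornerSite L c.1 + boxVec L ρ + (i : ℤ) • e c.2), c.2)‖ ^ 2) := mul_le_mul_of_nonneg_left hsum (by positivity)
      _ = ω ^ 2 * q c := by simp only [hq]; ring
  -- (iii) pointwise on the coarse bonds
  have hpt : ∀ c : Bond d m, ‖QtorusLin L m hL U hα1 hU1 hreg (fun b => r c b • A b) c‖ ^ 2 ≤ 2 * ((K₁ * (ω * s c)) ^ 2 + ω ^ 2 * q c) := by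
    intro c
    set X := QtorusLin L m hL U hα1 hU1 hreg (fun b => r c b • A b) c with hX
    set X₁ := QtorusLin L m hL (fun _ => 1) hα1' hU1' hreg' (fun b => r c b • A b) c with hX₁
    have hXle : ‖X‖ ≤ K₁ * (ω * s c) + ‖X₁‖ := by
      have h := norm_sub_norm_le X X₁
      linarith [hlip c]
    have hsum0 : 0 ≤ K₁ * (ω * s c) + ‖X₁‖ := by positivity
    calc ‖X‖ ^ 2 ≤ (K₁ * (ω * s c) + ‖X₁‖) ^ 2 := pow_le_pow_left₀ (norm_nonneg _) hXle 2
      _ ≤ 2 * ((K₁ * (ω * s c)) ^ 2 + ‖X₁‖ ^ 2) := by nlinarith [sq_nonneg (K₁ * (ω * s c) - ‖X₁‖)]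
      _ ≤ 2 * ((K₁ * (ω * s c)) ^ 2 + ω ^ 2 * q c) := by linarith [hflat c]
  -- (iv) the two global counts
  have hS1 : ∑ c : Bond d m, s c ^ 2 ≤ 2 * d * ∑ b : Bond d (fineP L m), ‖A b‖ ^ 2 := by
    have hsc : ∀ c : Bond d m, s c ^ 2 = ∑ b ∈ Finset.univ.filter
        (fun b : Bond d (fineP L m) => blockCoord L m b.1 = c.1 ∨ blockCoord L m b.1 = shift c.2 c.1), ‖A b‖ ^ 2 := fun c =>
      Real.sq_sqrt (Finset.sum_nonneg fun _ _ => sq_nonneg _)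
    rw [Finset.sum_congr rfl fun c _ => hsc c]
    exact sum_sum_near_le L m (fun b => ‖A b‖ ^ 2) fun _ => sq_nonneg _
  have hS2 : ∑ c : Bond d m, q c ≤ ((L : ℝ) ^ d)⁻¹ * ∑ b : Bond d (fineP L m), ‖A b‖ ^ 2 :=
    sum_flat_count_le L m hL (fun b => ‖A b‖ ^ 2) fun _ => sq_nonneg _
  -- (v) assemble
  calc ∑ c : Bond d m, ‖QtorusLin L m hL U hα1 hU1 hreg (fun b => r c b • A b) c‖ ^ 2
      ≤ ∑ c : Bond d m, 2 * ((K₁ * (ω * s c)) ^ 2 + ω ^ 2 * q c) := Finset.sum_le_sum fun c _ => hpt c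
    _ = 2 * (K₁ * ω) ^ 2 * ∑ c : Bond d m, s c ^ 2 + 2 * ω ^ 2 * ∑ c : Bond d m, q c := by
        rw [Finset.mul_sum, Finset.mul_sum, ← Finset.sum_add_distrib]
        exact Finset.sum_congr rfl fun c _ => by ring
    _ ≤ 2 * (K₁ * ω) ^ 2 * (2 * d * ∑ b : Bond d (fineP L m), ‖A b‖ ^ 2) + 2 * ω ^ 2 * (((L : ℝ) ^ d)⁻¹ * ∑ b : Bond d (fineP L m), ‖A b‖ ^ 2) :=
        add_le_add (mul_le_mul_of_nonneg_left hS1 (by positivity)) (mul_le_mul_of_nonneg_left hS2 (by positivity))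
    _ = ω ^ 2 * (2 * (2 * d * K₁ ^ 2 + ((L : ℝ) ^ d)⁻¹)) * ∑ b : Bond d (fineP L m), ‖A b‖ ^ 2 := by ring

include hα1' hU1' hreg' hεU hUε hMφ hφ hMφ' hφ' hℓ' hχ' hwin' hSinv hSF in
/-- **THE COMBES–THOMAS LETTER OF THE VECTOR AVERAGING, ONE STEP:
`‖S_F(Q(U)(S⁻¹f)) − Q(U)f‖ ≤ 2‖κ‖ℓ′·M_φ′M_φ·√(2(c₁∕c₀)·(2d·(102(d+1)²Lε_U)² + (L^d)⁻¹))·‖f‖`** — the identity of §1, `‖φ⁻¹X‖ ≤ M_φ′‖X‖`, the raw `ℓ²` form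
at `A = Φf` (`Σ‖Φf‖² ≤ M_φ²‖f‖²∕c₀`) and the coarse weight `c₁`. [cite: Balaban1985BackgroundPropagators, (3.15)–(3.16) p.393, (3.49) p.399, (3.83) p.407, (3.101) p.414] -/
theorem norm_conj_QtorusW_sub_le (f : BondL2K ℂ d (fineP L m) c₀ W) :
    ‖SF (QtorusW L m hL φ U hα1 hU1 hreg (c₁ := c₁) (Sinv f)) - QtorusW L m hL φ U hα1 hU1 hreg (c₁ := c₁) f‖ ≤
      2 * (‖κ‖ * ℓ') * (Mφ' * Mφ * Real.sqrt (2 * (c₁ / c₀) * (2 * d * (102 * (d + 1) ^ 2 * L * εU) ^ 2 + ((L : ℝ) ^ d)⁻¹))) * ‖f‖ := by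
  haveI : NeZero L := ⟨by omega⟩
  have hc₀ : 0 < c₀ := Fact.out
  have hc₁ : 0 < c₁ := Fact.out
  have hLd : (0 : ℝ) < (L : ℝ) ^ d := by positivity
  set ω : ℝ := 2 * (‖κ‖ * ℓ') with hω
  have hω0 : 0 ≤ ω := by positivity
  set R : ℝ := 2 * (2 * d * (102 * (d + 1) ^ 2 * L * εU) ^ 2 + ((L : ℝ) ^ d)⁻¹) with hR
  have hR0 : 0 ≤ R := by positivity
  set fv : Bond d (fineP L m) → W := WL2.equiv ℂ (fun _ : Bond d (fineP L m) => c₀) W f with hfv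
  set g : Bond d (fineP L m) → 𝔸 := fun b => φ (fv b) with hg
  -- the raw `ℓ²` letter at `A = Φf`
  have hraw := sum_norm_sq_QtorusLin_conj_le L m hL U hα1 hU1 hreg hα1' hU1' hreg' hεU hUε hℓ' hχ' hwin' (κ := κ) g
  have hf : ∑ b : Bond d (fineP L m), ‖fv b‖ ^ 2 = ‖f‖ ^ 2 / c₀ := by
    rw [eq_div_iff hc₀.ne', WL2.norm_sq f, Finset.sum_mul]
    exact Finset.sum_congr rfl fun b _ => by rw [hfv]; ring
  have hfine : ∑ b : Bond d (fineP L m), ‖g b‖ ^ 2 ≤ Mφ ^ 2 * (‖f‖ ^ 2 / c₀) := by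
    rw [← hf, Finset.mul_sum]
    refine Finset.sum_le_sum fun b _ => ?_
    calc ‖g b‖ ^ 2 ≤ (Mφ * ‖fv b‖) ^ 2 := pow_le_pow_left₀ (norm_nonneg _) (hφ _) 2
      _ = Mφ ^ 2 * ‖fv b‖ ^ 2 := by ring
  -- pointwise on the coarse bonds through `φ⁻¹`
  set D := SF (QtorusW L m hL φ U hα1 hU1 hreg (c₁ := c₁) (Sinv f)) - QtorusW L m hL φ U hα1 hU1 hreg (c₁ := c₁) f with hD
  have hpt : ∀ c : Bond d m, ‖WL2.equiv ℂ (fun _ : Bond d m => c₁) W D c‖ ^ 2 ≤ Mφ' ^ 2 * ‖QtorusLin L m hL U hα1 hU1 hreg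
      (fun b => (Complex.exp (κ * (χ' c.1 : ℂ)) * Complex.exp (-(κ * (χ b.1 : ℂ))) - 1) • g b) c‖ ^ 2 := by
    intro c
    rw [hD, WL2.equiv_sub, Pi.sub_apply, equiv_conj_QtorusW_sub L m hL φ U hα1 hU1 hreg (c₀ := c₀) (c₁ := c₁) hSinv hSF f c, ← mul_pow]
    exact pow_le_pow_left₀ (norm_nonneg _) (hφ' _) 2
  -- assemble with the coarse weight
  have hsq : ‖D‖ ^ 2 ≤ (ω * (Mφ' * Mφ * Real.sqrt (2 * (c₁ / c₀) * (2 * d * (102 * (d + 1) ^ 2 * L * εU) ^ 2 + ((L : ℝ) ^ d)⁻¹))) * ‖f‖) ^ 2 :=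
    calc ‖D‖ ^ 2 = ∑ c : Bond d m, c₁ * ‖WL2.equiv ℂ (fun _ : Bond d m => c₁) W D c‖ ^ 2 := WL2.norm_sq (𝕜 := ℂ) (w := fun _ : Bond d m => c₁) (V := W) D
      _ ≤ ∑ c : Bond d m, c₁ * (Mφ' ^ 2 * ‖QtorusLin L m hL U hα1 hU1 hreg
            (fun b => (Complex.exp (κ * (χ' c.1 : ℂ)) * Complex.exp (-(κ * (χ b.1 : ℂ))) - 1) • g b) c‖ ^ 2) :=
          Finset.sum_le_sum fun c _ => mul_le_mul_of_nonneg_left (hpt c) hc₁.le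
      _ = c₁ * Mφ' ^ 2 * ∑ c : Bond d m, ‖QtorusLin L m hL U hα1 hU1 hreg
            (fun b => (Complex.exp (κ * (χ' c.1 : ℂ)) * Complex.exp (-(κ * (χ b.1 : ℂ))) - 1) • g b) c‖ ^ 2 := by
          rw [Finset.mul_sum]; exact Finset.sum_congr rfl fun c _ => by ring
      _ ≤ c₁ * Mφ' ^ 2 * (ω ^ 2 * R * ∑ b : Bond d (fineP L m), ‖g b‖ ^ 2) := mul_le_mul_of_nonneg_left hraw (by positivity)
      _ ≤ c₁ * Mφ' ^ 2 * (ω ^ 2 * R * (Mφ ^ 2 * (‖f‖ ^ 2 / c₀))) :=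
          mul_le_mul_of_nonneg_left (mul_le_mul_of_nonneg_left hfine (by positivity)) (by positivity)
      _ = (ω * (Mφ' * Mφ * Real.sqrt (2 * (c₁ / c₀) * (2 * d * (102 * (d + 1) ^ 2 * L * εU) ^ 2 + ((L : ℝ) ^ d)⁻¹))) * ‖f‖) ^ 2 := by
          have hCC : Real.sqrt (2 * (c₁ / c₀) * (2 * d * (102 * (d + 1) ^ 2 * L * εU) ^ 2 + ((L : ℝ) ^ d)⁻¹)) ^ 2 = (c₁ / c₀) * R := by
            rw [Real.sq_sqrt (by positivity), hR]; ring
          rw [show ∀ x y z w : ℝ, (x * (y * z) * w) ^ 2 = x ^ 2 * y ^ 2 * z ^ 2 * w ^ 2 from fun x y z w => by ring, hCC]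
          simp only [div_eq_mul_inv]
          ring
  have h0 : 0 ≤ ω * (Mφ' * Mφ * Real.sqrt (2 * (c₁ / c₀) * (2 * d * (102 * (d + 1) ^ 2 * L * εU) ^ 2 + ((L : ℝ) ^ d)⁻¹))) * ‖f‖ := by positivity
  have h := (pow_le_pow_iff_left₀ (norm_nonneg _) h0 two_ne_zero).1 hsq
  rw [hω] at h
  exact h

end Letter

/-! ## §3 The adjoint reading and the factorisation (the `hQfac`∕`dQ`∕`dQ′` letters) -/

section Adjoint

variable {𝔸 : Type*} [NormedRing 𝔸] [NormedAlgebra ℂ 𝔸] [CompleteSpace 𝔸] [NormOneClass 𝔸] (hL : 1 ≤ L)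
  (U : Bond d (fineP L m) → 𝔸ˣ) {α : ℝ} (hα1 : α ≤ 1 / 64)
  (hU1 : ∀ (x : B7Prop1Explicit.Site d) (κ : Fin d), perCfg (fineP L m) U x κ ∈ U1 𝔸)
  (hreg : ∀ (y : TSite d m) (κ : Fin d) (r : Fin d → Fin L),
    ‖((Wcx L (perCfg (fineP L m) U) (cornerSite L y) κ (boxVec L r) : 𝔸ˣ) : 𝔸) - 1‖ ≤ α)
  {α' : ℝ} (hα1' : α' ≤ 1 / 64)
  (hU1' : ∀ (x : B7Prop1Explicit.Site d) (κ : Fin d), perCfg (fineP L m) (fun _ : Bond d (fineP L m) => (1 : 𝔸ˣ)) x κ ∈ U1 𝔸)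
  (hreg' : ∀ (y : TSite d m) (κ : Fin d) (r : Fin d → Fin L),
    ‖((Wcx L (perCfg (fineP L m) (fun _ : Bond d (fineP L m) => (1 : 𝔸ˣ))) (cornerSite L y) κ (boxVec L r) : 𝔸ˣ) : 𝔸) - 1‖ ≤ α')
  {εU : ℝ} (hεU : 0 ≤ εU) (hUε : ∀ b : Bond d (fineP L m), ‖(U b : 𝔸) - 1‖ ≤ εU)
  {W : Type*} [NormedAddCommGroup W] [InnerProductSpace ℂ W] [FiniteDimensional ℂ W] (φ : W ≃ₗ[ℂ] 𝔸) {c₀ c₁ : ℝ}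
  [Fact (0 < c₀)] [Fact (0 < c₁)]
  {Mφ Mφ' : ℝ} (hMφ : 0 ≤ Mφ) (hφ : ∀ w, ‖φ w‖ ≤ Mφ * ‖w‖) (hMφ' : 0 ≤ Mφ') (hφ' : ∀ X, ‖φ.symm X‖ ≤ Mφ' * ‖X‖)
  {κ : ℂ} {χ : TSite d (fineP L m) → ℝ} {χ' : TSite d m → ℝ} {ℓ' : ℝ} (hℓ' : 0 ≤ ℓ')
  (hχ' : ∀ (c : Bond d m) (b : Bond d (fineP L m)), (blockCoord L m b.1 = c.1 ∨ blockCoord L m b.1 = shift c.2 c.1) → |χ' c.1 - χ b.1| ≤ ℓ')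
  (hwin' : ‖κ‖ * ℓ' ≤ 1)
  {S Sinv : BondL2K ℂ d (fineP L m) c₀ W →ₗ[ℂ] BondL2K ℂ d (fineP L m) c₀ W}
  (hS : ∀ (f : BondL2K ℂ d (fineP L m) c₀ W) (b : Bond d (fineP L m)),
    WL2.equiv ℂ (fun _ : Bond d (fineP L m) => c₀) W (S f) b =
      Complex.exp (κ * (χ b.1 : ℂ)) • WL2.equiv ℂ (fun _ : Bond d (fineP L m) => c₀) W f b)
  (hSinv : ∀ (f : BondL2K ℂ d (fineP L m) c₀ W) (b : Bond d (fineP L m)),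
    WL2.equiv ℂ (fun _ : Bond d (fineP L m) => c₀) W (Sinv f) b =
      Complex.exp (-(κ * (χ b.1 : ℂ))) • WL2.equiv ℂ (fun _ : Bond d (fineP L m) => c₀) W f b)
  {SF SFinv : BondL2K ℂ d m c₁ W →ₗ[ℂ] BondL2K ℂ d m c₁ W}
  (hSF : ∀ (g : BondL2K ℂ d m c₁ W) (c : Bond d m),
    WL2.equiv ℂ (fun _ : Bond d m => c₁) W (SF g) c = Complex.exp (κ * (χ' c.1 : ℂ)) • WL2.equiv ℂ (fun _ : Bond d m => c₁) W g c)
  (hSFinv : ∀ (g : BondL2K ℂ d m c₁ W) (c : Bond d m),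
    WL2.equiv ℂ (fun _ : Bond d m => c₁) W (SFinv g) c = Complex.exp (-(κ * (χ' c.1 : ℂ))) • WL2.equiv ℂ (fun _ : Bond d m => c₁) W g c)

include hα1' hU1' hreg' hεU hUε hMφ hφ hMφ' hφ' hℓ' hχ' hwin' hS hSFinv in
/-- **… AT `−κ̄` THROUGH THE ADJOINTS' POINTWISE ACTION**: `‖(S_F⁻¹)†(Q(U)(S†f)) − Q(U)f‖ ≤` the §2 constant `× ‖f‖` for `S`, `S_F⁻¹` acting as `e^{κχ}`,
`e^{−κχ′}` (`B9Eq311PointwiseMultipliers.equiv_adjoint_of_pointwise`). [folklore] [cite: Balaban1985BackgroundPropagators, (3.15) p.393, (3.49) p.399, (3.101) p.414] -/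
theorem norm_conj_QtorusW_sub_le_negConj (f : BondL2K ℂ d (fineP L m) c₀ W) :
    ‖LinearMap.adjoint SFinv (QtorusW L m hL φ U hα1 hU1 hreg (c₁ := c₁) (LinearMap.adjoint S f)) -
        QtorusW L m hL φ U hα1 hU1 hreg (c₁ := c₁) f‖ ≤
      2 * (‖κ‖ * ℓ') * (Mφ' * Mφ * Real.sqrt (2 * (c₁ / c₀) * (2 * d * (102 * (d + 1) ^ 2 * L * εU) ^ 2 + ((L : ℝ) ^ d)⁻¹))) * ‖f‖ := by
  have hA : ∀ (g : BondL2K ℂ d m c₁ W) (c : Bond d m),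
      WL2.equiv ℂ (fun _ : Bond d m => c₁) W (LinearMap.adjoint SFinv g) c =
        Complex.exp (-conj κ * (χ' c.1 : ℂ)) • WL2.equiv ℂ (fun _ : Bond d m => c₁) W g c := by
    intro g c
    rw [B9Eq311PointwiseMultipliers.equiv_adjoint_of_pointwise SFinv _ hSFinv, ← Complex.exp_conj, map_neg, map_mul, Complex.conj_ofReal,
      neg_mul]
  have hB : ∀ (f : BondL2K ℂ d (fineP L m) c₀ W) (b : Bond d (fineP L m)),
      WL2.equiv ℂ (fun _ : Bond d (fineP L m) => c₀) W (LinearMap.adjoint S f) b =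
        Complex.exp (-(-conj κ * (χ b.1 : ℂ))) • WL2.equiv ℂ (fun _ : Bond d (fineP L m) => c₀) W f b := by
    intro f b
    rw [B9Eq311PointwiseMultipliers.equiv_adjoint_of_pointwise S _ hS, ← Complex.exp_conj, map_mul, Complex.conj_ofReal, neg_mul, neg_neg]
  have hwin1 : ‖-conj κ‖ * ℓ' ≤ 1 := by rwa [norm_neg, Complex.norm_conj]
  have h := norm_conj_QtorusW_sub_le L m hL U hα1 hU1 hreg hα1' hU1' hreg' hεU hUε φ (c₀ := c₀) (c₁ := c₁) hMφ hφ hMφ' hφ' hℓ' hχ' hwin1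
    hB hA f
  rwa [norm_neg, Complex.norm_conj] at h

include hα1' hU1' hreg' hεU hUε hMφ hφ hMφ' hφ' hℓ' hχ' hwin' hS hSFinv in
/-- **THE ADJOINT READING `‖S(Q(U)†(S_F⁻¹g)) − Q(U)†g‖ ≤ 2‖κ‖ℓ′·M_φ′M_φ·√(2(c₁∕c₀)(2d(102(d+1)²Lε_U)² + L^{−d}))·‖g‖`** (a bound passes through the
pairing, `B9Eq311PointwiseMultipliers.norm_conj_adjoint_sub_le`) — the `dQ′` letter with `Q′_κ := S∘Q†∘S_F⁻¹`. [folklore]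
[cite: Balaban1985BackgroundPropagators, (3.15)–(3.16) p.393, (3.26) p.395, (3.49) p.399, (3.101) p.414] -/
theorem norm_conj_adjoint_QtorusW_sub_le (g : BondL2K ℂ d m c₁ W) :
    ‖(S ∘ₗ LinearMap.adjoint (QtorusW L m hL φ U hα1 hU1 hreg (c₀ := c₀) (c₁ := c₁)) ∘ₗ SFinv) g -
        LinearMap.adjoint (QtorusW L m hL φ U hα1 hU1 hreg (c₀ := c₀) (c₁ := c₁)) g‖ ≤
      2 * (‖κ‖ * ℓ') * (Mφ' * Mφ * Real.sqrt (2 * (c₁ / c₀) * (2 * d * (102 * (d + 1) ^ 2 * L * εU) ^ 2 + ((L : ℝ) ^ d)⁻¹))) * ‖g‖ := by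
  have hc₀ : 0 < c₀ := Fact.out
  have hc₁ : 0 < c₁ := Fact.out
  exact B9Eq311PointwiseMultipliers.norm_conj_adjoint_sub_le (𝕜 := ℂ) (E := BondL2K ℂ d (fineP L m) c₀ W) (F := BondL2K ℂ d m c₁ W)
    (QtorusW L m hL φ U hα1 hU1 hreg (c₀ := c₀) (c₁ := c₁)) SFinv S (by positivity)
    (fun f => by
      rw [LinearMap.comp_apply, LinearMap.comp_apply]
      exact norm_conj_QtorusW_sub_le_negConj L m hL U hα1 hU1 hreg hα1' hU1' hreg' hεU hUε φ hMφ hφ hMφ' hφ' hℓ' hχ' hwin' hS hSFinv f) g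

omit [∀ i, NeZero (fineP L m i)] [CompleteSpace 𝔸] [NormOneClass 𝔸] [Fact (0 < c₀)] [Fact (0 < c₁)] in
/-- **THE FACTORISATION `S(Q†(a•Q(S⁻¹f))) = a•(S∘Q†∘S_F⁻¹)((S_F∘Q∘S⁻¹)f)`** given `S_F⁻¹S_F = 1` — the `hQfac` hypothesis of
`B9Eq326ConjugatedLocalPart.norm_conjLocalInv_le` ∕ `B9Eq326ConjugatedDeltaA.norm_conjG1ofU_le` with `Qk := S_F ∘ₗ Q ∘ₗ Sinv`, `Qk′ := S ∘ₗ Q† ∘ₗ S_Finv`, for ANY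
linear `Q`. [folklore] [cite: Balaban1985BackgroundPropagators, (3.26) p.395, (3.49) p.399] -/
theorem conj_QadjQ_factor [Fact (0 < c₀)] [Fact (0 < c₁)] (Q : BondL2K ℂ d (fineP L m) c₀ W →ₗ[ℂ] BondL2K ℂ d m c₁ W)
    (hSFinvSF : ∀ g, SFinv (SF g) = g) (a : ℝ) (f : BondL2K ℂ d (fineP L m) c₀ W) :
    S (LinearMap.adjoint Q (((a : ℝ) : ℂ) • Q (Sinv f))) =
      ((a : ℝ) : ℂ) • (S ∘ₗ LinearMap.adjoint Q ∘ₗ SFinv) ((SF ∘ₗ Q ∘ₗ Sinv) f) := by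
  simp only [LinearMap.comp_apply, hSFinvSF, map_smul]

end Adjoint

end Literature.MathematicalPhysics.QuantumFieldTheory.Balaban1983to89.B9Eq349ConjugatedQLetters

end
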